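import Summits.Ventures.LatticeQCDFlow.Scoring.SU2TorusAnnulusMerging
import HarnessLib

/-!
# SU(2) on the 2-torus: the Haar integral of a product of plaquette characters WITH POLYAKOV LINES INSERTED

HONEST FRAMING: exact (Metropolis-corrected) sampling algorithms for lattice gauge theory;
figures of merit are autocorrelation/cost numbers at stated couplings and volumes; no
continuum-physics claim.

Venture `LatticeQCDFlow` (cell pub-lqcd), sub-topic `Scoring`; FANOUT row 5 (`s0-sun-a`), GEN-11.
NEW WORK of the cell (placement rule); towards the EXACT finite-volume SU(2) Polyakov-loop expectation
and two-point function on `(ℤ/L)²` (oracle X02's `polyakov_loop` / `polyakov_2pt`).  `P_j(V) = h(i,j)⋯h(i+L−1,j)`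
is the Polyakov line (row holonomy) through `(i,j)`, `χ_n = U_n(a₀)`, and
`κ(μ,λ) = ∫ a₀χ_μχ_λ dHaar = ½[λ = μ+1] + ½[μ ≠ 0][λ = μ−1]`.

* **`integral_su2a0_polyakov_mul_prod_su2Character`** — ONE line: `∫ a₀(P_j)·∏_x χ_{m_x}(U_x) dHaar^{⊗E} = 0`
  for every `m` (the torus cut along `P_j` merges to `χ(P_j)²/(m+1)^{L²}`, and `∫ a₀χ_mχ_m = 0`):
  centre symmetry, exactly;
* `annulusSites_compl` — the rows `j+T..j+L−1` are the complement of the rows `j..j+T−1`;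
* **`integral_su2a0_polyakov_pair_mul_prod_su2Character`** — TWO lines at heights `j`, `j+T`,
  `1 ≤ T ≤ L−1`, with `μ = m(i,j)`, `λ = m(i,j+T)`:
  `∫ a₀(P_j)a₀(P_{j+T})·∏_x χ_{m_x}(U_x) dHaar^{⊗E}
     = [m ≡ μ on rows j..j+T−1]·[m ≡ λ on the other rows]·((μ+1)^{LT})⁻¹((λ+1)^{L(L−T)})⁻¹·κ(μ,λ)²`
  — both annuli merge onto the two loops (`SU2TorusAnnulusMerging`), which are then independent Haar
  variables.

Elementary given the parents; nothing is cited; no `def`.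
-/

noncomputable section

open Real MeasureTheory Set Function Finset Polynomial.Chebyshev
open Literature.MathematicalPhysics.QuantumFieldTheory Literature.MathematicalPhysics.QuantumLattice
open Summit.Ventures.LatticeQCDFlow.Exactness
open Summit.Ventures.LatticeQCDFlow.Theory2.Lattice

namespace Summit.Ventures.LatticeQCDFlow.Scoring

variable {L : ℕ} [NeZero L]

/-! ## §4. One Polyakov line: centre symmetry -/

/-- The rectangle with `R = T = L` is the whole torus. -/
theorem rect_eq_univ (i j : ZMod L) :
    (range L ×ˢ range L).image (fun p : ℕ × ℕ => (![i + p.1, j + p.2] : Site 2 L)) = Finset.univ :=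
  Finset.eq_univ_of_card _ (by rw [card_rectSites i j le_rfl le_rfl, Flux.card_site_two, sq])

/-- **ONE POLYAKOV LINE INTEGRATES TO ZERO against every product of plaquette characters**:
`∫ a₀(P_j) · ∏_x χ_{m_x}(U_x) dHaar^{⊗E} = 0` (`P_j = h(i,j)⋯h(i+L−1,j)`) — the whole torus merges to
`χ(P_j)²/(m+1)^{L²}` against the spectator `a₀(P_j)`, and `∫ a₀ χ_m χ_m dHaar = 0`: centre symmetry,
exactly, in every finite volume. -/
theorem integral_su2a0_polyakov_mul_prod_su2Character (i j : ZMod L) (m : Site 2 L → ℕ) :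
    ∫ V, su2a0 (((List.range L).map fun a : ℕ => V (![i + a, j], 0)).prod) *
        ∏ x : Site 2 L, (U ℝ (m x)).eval (su2a0 (plaquetteHolonomy V x 0 1))
        ∂(Measure.pi fun _ : Edge 2 L => haarProbability (Matrix.specialUnitaryGroup (Fin 2) ℂ)) = 0 := by
  have hL : 1 ≤ L := Nat.one_le_iff_ne_zero.mpr (NeZero.ne L)
  have hsplit : ∀ V : GaugeConfig 2 L (Matrix.specialUnitaryGroup (Fin 2) ℂ),
      ∏ x : Site 2 L, (U ℝ (m x)).eval (su2a0 (plaquetteHolonomy V x 0 1)) =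
      ∏ b ∈ range L, ∏ a ∈ range L,
        (U ℝ (m ![i + a, j + b])).eval (su2a0 (plaquetteHolonomy V ![i + a, j + b] 0 1)) := by
    intro V
    have h := prod_rect_eq i j le_rfl le_rfl (fun x => (U ℝ (m x)).eval (su2a0 (plaquetteHolonomy V x 0 1)))
    rw [rect_eq_univ] at h
    exact h
  simp_rw [hsplit]
  have hPc : Continuous fun V : GaugeConfig 2 L (Matrix.specialUnitaryGroup (Fin 2) ℂ) =>
      ((List.range L).map fun a : ℕ => V (![i + a, j], 0)).prod :=
    continuous_list_prod _ fun k _ => continuous_apply _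
  rw [integral_mul_prod_annulus_su2Character i j m hL le_rfl
    (fun V => su2a0 (((List.range L).map fun a : ℕ => V (![i + a, j], 0)).prod)) (continuous_su2a0.comp hPc)
    (fun a b _ _ V g => by
      show su2a0 _ = su2a0 _
      rw [rowProd_update_of_ne i j V _ g (Or.inl rfl) L])
    (fun b hb0 hbL V g => by
      show su2a0 _ = su2a0 _
      rw [rowProd_update_of_ne i j V _ g (Or.inr ?_) L]
      intro h
      change j + (b : ZMod L) = j at h
      exact absurd (Nat.le_of_dvd hb0 ((ZMod.natCast_eq_zero_iff b L).1 (add_eq_left.mp h))) (by omega))]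
  by_cases hC : ∀ a < L, ∀ b < L, m ![i + a, j + b] = m ![i, j]
  swap
  · rw [if_neg hC]
  rw [if_pos hC, ZMod.natCast_self, add_zero]
  obtain ⟨L₀, rfl⟩ : ∃ L₀, L = L₀ + 1 := ⟨L - 1, by omega⟩
  -- the row holonomy is Haar distributed: peel off its first link
  have hrow : ∀ V : GaugeConfig 2 (L₀ + 1) (Matrix.specialUnitaryGroup (Fin 2) ℂ),
      ((List.range (L₀ + 1)).map fun a : ℕ => V (![i + a, j], 0)).prod =
        V (![i, j], 0) * ((List.range L₀).map fun a : ℕ => V (![i + (a + 1 : ℕ), j], 0)).prod := by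
    intro V
    rw [list_prod_range_succ_eq_head_mul, Nat.cast_zero, add_zero]
  simp_rw [hrow]
  have hT : ∀ (w : GaugeConfig 2 (L₀ + 1) (Matrix.specialUnitaryGroup (Fin 2) ℂ)) g,
      ((List.range L₀).map fun a : ℕ => update w (![i, j], 0) g (![i + (a + 1 : ℕ), j], 0)).prod =
        ((List.range L₀).map fun a : ℕ => w (![i + (a + 1 : ℕ), j], 0)).prod := by
    intro w g
    refine list_prod_map_update_of_ne w _ g _ _ fun k hk h => ?_
    rw [List.mem_range] at hk
    rw [Prod.mk.injEq, vec2_eq_iff] at h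
    exact absurd (Nat.le_of_dvd (Nat.succ_pos k) ((ZMod.natCast_eq_zero_iff (k + 1) (L₀ + 1)).1
      (add_eq_left.mp h.1.1))) (by omega)
  have hPc' : Continuous fun w : GaugeConfig 2 (L₀ + 1) (Matrix.specialUnitaryGroup (Fin 2) ℂ) =>
      w (![i, j], 0) * ((List.range L₀).map fun a : ℕ => w (![i + (a + 1 : ℕ), j], 0)).prod :=
    (continuous_apply _).mul (continuous_list_prod _ fun k _ => continuous_apply _)
  have h := integral_pi_mul_of_update_eq (ι := Edge 2 (L₀ + 1))
    (haarProbability (Matrix.specialUnitaryGroup (Fin 2) ℂ)) (![i, j], 0)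
    (fun w => ((List.range L₀).map fun a : ℕ => w (![i + (a + 1 : ℕ), j], 0)).prod) hT
    (fun g => su2a0 g * ((U ℝ (m ![i, j])).eval (su2a0 g) * (U ℝ (m ![i, j])).eval (su2a0 g)))
    (integrable_pi_su2_of_continuous ((continuous_su2a0.comp hPc').mul
      ((continuous_su2Character_comp _ hPc').mul (continuous_su2Character_comp _ hPc'))))
  rw [h]
  have h2 : ∫ g, su2a0 g * ((U ℝ (m ![i, j])).eval (su2a0 g) * (U ℝ (m ![i, j])).eval (su2a0 g))
      ∂(haarProbability (Matrix.specialUnitaryGroup (Fin 2) ℂ)) = 0 := by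
    simp_rw [← mul_assoc]
    rw [integral_su2a0_mul_su2Character_mul_su2Character]
    have h1 : ¬ m ![i, j] = m ![i, j] + 1 := by omega
    rw [if_neg h1]
    by_cases h0 : m ![i, j] = 0
    · rw [if_pos h0]; simp
    · rw [if_neg h0, if_neg (by omega)]; simp
  rw [h2, mul_zero]

/-- The rows `j+T, …, j+L−1` are the complement of the rows `j, …, j+T−1` (`T ≤ L`). -/
theorem annulusSites_compl (i j : ZMod L) {T : ℕ} (hTL : T ≤ L) :
    (range L ×ˢ range (L - T)).image (fun p : ℕ × ℕ => (![i + p.1, j + T + p.2] : Site 2 L)) =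
      ((range L ×ˢ range T).image (fun p : ℕ × ℕ => (![i + p.1, j + p.2] : Site 2 L)))ᶜ := by
  refine Finset.eq_of_subset_of_card_le (fun x hx => ?_) ?_
  · rw [Finset.mem_compl]
    intro hxA
    obtain ⟨q, hq, rfl⟩ := Finset.mem_image.mp hx
    obtain ⟨p, hp, hpq⟩ := Finset.mem_image.mp hxA
    rw [Finset.mem_product, Finset.mem_range, Finset.mem_range] at hq hp
    have h2 := (vec2_eq_iff.mp hpq).2
    rw [add_assoc, ← Nat.cast_add] at h2
    exact natCast_zmod_ne_of_lt (by omega) (by omega) (by omega) (add_left_cancel h2)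
  · rw [Finset.card_compl, card_rectSites i j le_rfl hTL, card_rectSites i (j + T) le_rfl (by omega),
      Flux.card_site_two, mul_tsub, sq]

/-! ## §5. Two Polyakov lines -/

/-- **THE CHARACTER INTEGRAL WITH TWO POLYAKOV LINES INSERTED.**  For `L ≥ 2`, a base point `(i,j)`,
a separation `1 ≤ T ≤ L − 1`, every `m : Λ → ℕ` and product Haar measure on the links of `(ℤ/L)²`, with
`P_j`, `P_{j+T}` the row holonomies at heights `j`, `j+T`, `μ = m(i,j)`, `λ = m(i,j+T)` and
`κ(μ,λ) = ∫ a₀χ_μχ_λ dHaar = ½[λ = μ+1] + ½[μ ≠ 0][λ = μ−1]`: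
`∫ a₀(P_j)·a₀(P_{j+T})·∏_x χ_{m_x}(U_x) dHaar^{⊗E}
   = [m ≡ μ on the rows j..j+T−1]·[m ≡ λ on the rows j+T..j+L−1]·((μ+1)^{LT})⁻¹·((λ+1)^{L(L−T)})⁻¹·κ(μ,λ)²`
— the two annuli merge onto their boundary circles (`integral_mul_prod_annulus_su2Character`), which are
then independent Haar variables. -/
theorem integral_su2a0_polyakov_pair_mul_prod_su2Character (i j : ZMod L) {T : ℕ} (hT : 1 ≤ T)
    (hTL : T + 1 ≤ L) (m : Site 2 L → ℕ) :
    ∫ V, su2a0 (((List.range L).map fun a : ℕ => V (![i + a, j], 0)).prod) *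
          su2a0 (((List.range L).map fun a : ℕ => V (![i + a, j + T], 0)).prod) *
        ∏ x : Site 2 L, (U ℝ (m x)).eval (su2a0 (plaquetteHolonomy V x 0 1))
        ∂(Measure.pi fun _ : Edge 2 L => haarProbability (Matrix.specialUnitaryGroup (Fin 2) ℂ)) =
      if (∀ a < L, ∀ b < T, m ![i + a, j + b] = m ![i, j]) then
        if (∀ a < L, ∀ b < L - T, m ![i + a, j + T + b] = m ![i, j + T]) then
          ((((m ![i, j] : ℝ) + 1) ^ (L * T)))⁻¹ * (((((m ![i, j + T] : ℝ) + 1) ^ (L * (L - T))))⁻¹ *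
            ((1 / 2) * (if m ![i, j + T] = m ![i, j] + 1 then (1 : ℝ) else 0) +
              (1 / 2) * (if m ![i, j] = 0 then (0 : ℝ) else
                if m ![i, j + T] = m ![i, j] - 1 then 1 else 0)) ^ 2)
        else 0
      else 0 := by
  have hL : 1 ≤ L := by omega
  have hTL' : T < L := by omega
  have hT0 : (T : ZMod L) ≠ 0 := fun h =>
    absurd (Nat.le_of_dvd hT ((ZMod.natCast_eq_zero_iff T L).1 h)) (by omega)
  set A := (range L ×ˢ range T).image (fun p : ℕ × ℕ => (![i + p.1, j + p.2] : Site 2 L)) with hA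
  set A' := (range L ×ˢ range (L - T)).image
    (fun p : ℕ × ℕ => (![i + p.1, j + T + p.2] : Site 2 L)) with hA'
  -- the second annulus is the complement of the first
  have hA'c : A' = Aᶜ := annulusSites_compl i j hTL'.le
  -- split the plaquettes into the two annuli
  have hsplit : ∀ V : GaugeConfig 2 L (Matrix.specialUnitaryGroup (Fin 2) ℂ),
      ∏ x : Site 2 L, (U ℝ (m x)).eval (su2a0 (plaquetteHolonomy V x 0 1)) =
      (∏ b ∈ range T, ∏ a ∈ range L,
        (U ℝ (m ![i + a, j + b])).eval (su2a0 (plaquetteHolonomy V ![i + a, j + b] 0 1))) *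
      ∏ b ∈ range (L - T), ∏ a ∈ range L,
        (U ℝ (m ![i + a, j + T + b])).eval (su2a0 (plaquetteHolonomy V ![i + a, j + T + b] 0 1)) := by
    intro V
    rw [← Finset.prod_mul_prod_compl A, prod_rect_eq i j le_rfl hTL'.le, ← hA'c,
      prod_rect_eq i (j + T) le_rfl (by omega)]
  -- the Polyakov lines and their behaviour under link updates
  set P : GaugeConfig 2 L (Matrix.specialUnitaryGroup (Fin 2) ℂ) → Matrix.specialUnitaryGroup (Fin 2) ℂ :=
    fun V => ((List.range L).map fun a : ℕ => V (![i + a, j], 0)).prod with hP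
  set P' : GaugeConfig 2 L (Matrix.specialUnitaryGroup (Fin 2) ℂ) → Matrix.specialUnitaryGroup (Fin 2) ℂ :=
    fun V => ((List.range L).map fun a : ℕ => V (![i + a, j + T], 0)).prod with hP'
  have hPdef : ∀ V : GaugeConfig 2 L (Matrix.specialUnitaryGroup (Fin 2) ℂ),
      ((List.range L).map fun a : ℕ => V (![i + a, j], 0)).prod = P V := fun V => rfl
  have hP'def : ∀ V : GaugeConfig 2 L (Matrix.specialUnitaryGroup (Fin 2) ℂ),
      ((List.range L).map fun a : ℕ => V (![i + a, j + T], 0)).prod = P' V := fun V => rfl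
  simp_rw [hPdef, hP'def]
  have hPc : Continuous P := continuous_list_prod _ fun k _ => continuous_apply _
  have hP'c : Continuous P' := continuous_list_prod _ fun k _ => continuous_apply _
  have hPu : ∀ (e : Edge 2 L) g V, e.2 = 1 ∨ e.1 1 ≠ j → P (update V e g) = P V :=
    fun e g V he => rowProd_update_of_ne i j V e g he L
  have hP'u : ∀ (e : Edge 2 L) g V, e.2 = 1 ∨ e.1 1 ≠ j + T → P' (update V e g) = P' V :=
    fun e g V he => rowProd_update_of_ne i (j + T) V e g he L
  -- Step 1: the first annulus
  set ρ' : GaugeConfig 2 L (Matrix.specialUnitaryGroup (Fin 2) ℂ) → ℝ := fun V =>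
    ∏ b ∈ range (L - T), ∏ a ∈ range L,
      (U ℝ (m ![i + a, j + T + b])).eval (su2a0 (plaquetteHolonomy V ![i + a, j + T + b] 0 1)) with hρ'
  have hρ'c : Continuous ρ' := by
    refine continuous_finsetProd _ fun b _ => continuous_finsetProd _ fun a _ =>
      continuous_su2Character_comp _ ?_
    unfold plaquetteHolonomy
    fun_prop
  have hρ'v : ∀ a b : ℕ, a < L → b < T → ∀ V g, ρ' (update V (![i + a, j + b], 1) g) = ρ' V := by
    intro a b ha hb V g
    simp only [hρ']
    refine Finset.prod_congr rfl fun b' hb' => Finset.prod_congr rfl fun a' _ => ?_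
    rw [Finset.mem_range] at hb'
    rw [plaquetteHolonomy_update_vert_of_row_ne (fun h => ?_) V g]
    change j + (T : ZMod L) + (b' : ZMod L) = j + (b : ZMod L) at h
    rw [add_assoc, ← Nat.cast_add] at h
    exact natCast_zmod_ne_of_lt (by omega) (by omega) (by omega) (add_left_cancel h)
  have hρ'h : ∀ b : ℕ, 0 < b → b < T → ∀ V g, ρ' (update V (![i, j + b], 0) g) = ρ' V := by
    intro b hb0 hb V g
    simp only [hρ']
    refine Finset.prod_congr rfl fun b' hb' => Finset.prod_congr rfl fun a' _ => ?_
    rw [Finset.mem_range] at hb'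
    rw [plaquetteHolonomy_update_horiz_of_row_ne (fun h => ?_) (fun h => ?_) V g]
    · change j + (T : ZMod L) + (b' : ZMod L) = j + (b : ZMod L) at h
      rw [add_assoc, ← Nat.cast_add] at h
      exact natCast_zmod_ne_of_lt (by omega) (by omega) (by omega) (add_left_cancel h)
    · change j + (T : ZMod L) + (b' : ZMod L) + 1 = j + (b : ZMod L) at h
      rw [add_assoc, add_assoc, ← Nat.cast_succ, ← Nat.cast_add] at h
      exact natCast_zmod_ne_of_pos_lt_le hb0 (by omega : b < T + (b' + 1)) (by omega : T + (b' + 1) ≤ L)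
        (add_left_cancel h).symm
  have hre1 : ∀ V : GaugeConfig 2 L (Matrix.specialUnitaryGroup (Fin 2) ℂ),
      su2a0 (P V) * su2a0 (P' V) * ∏ x : Site 2 L, (U ℝ (m x)).eval (su2a0 (plaquetteHolonomy V x 0 1)) =
      (su2a0 (P V) * su2a0 (P' V) * ρ' V) * ∏ b ∈ range T, ∏ a ∈ range L,
        (U ℝ (m ![i + a, j + b])).eval (su2a0 (plaquetteHolonomy V ![i + a, j + b] 0 1)) := by
    intro V
    rw [hsplit V]
    simp only [hρ']
    ring
  simp_rw [hre1]
  rw [integral_mul_prod_annulus_su2Character i j m hT hTL'.le (fun V => su2a0 (P V) * su2a0 (P' V) * ρ' V)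
    ((((continuous_su2a0.comp hPc).mul (continuous_su2a0.comp hP'c))).mul hρ'c)
    (fun a b ha hb V g => by
      show su2a0 _ * su2a0 _ * ρ' _ = _
      rw [hPu _ g V (Or.inl rfl), hP'u _ g V (Or.inl rfl), hρ'v a b ha hb])
    (fun b hb0 hb V g => by
      show su2a0 _ * su2a0 _ * ρ' _ = _
      rw [hPu _ g V (Or.inr ?_), hP'u _ g V (Or.inr ?_), hρ'h b hb0 hb]
      · change j + (b : ZMod L) ≠ j + (T : ZMod L)
        exact fun h => natCast_zmod_ne_of_lt (by omega) hTL' (by omega) (add_left_cancel h)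
      · change j + (b : ZMod L) ≠ j
        exact fun h => absurd (Nat.le_of_dvd hb0 ((ZMod.natCast_eq_zero_iff b L).1 (add_eq_left.mp h)))
          (by omega))]
  by_cases hC1 : ∀ a < L, ∀ b < T, m ![i + a, j + b] = m ![i, j]
  swap
  · rw [if_neg hC1, if_neg hC1]
  rw [if_pos hC1, if_pos hC1]
  simp_rw [hPdef, hP'def]
  -- Step 2: the second annulus
  set μ := m ![i, j] with hμ
  set Gs : GaugeConfig 2 L (Matrix.specialUnitaryGroup (Fin 2) ℂ) → ℝ := fun V =>
    su2a0 (P V) * su2a0 (P' V) * ((U ℝ μ).eval (su2a0 (P V)) * (U ℝ μ).eval (su2a0 (P' V))) with hGs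
  have hGsc : Continuous Gs := by
    simp only [hGs]
    exact ((continuous_su2a0.comp hPc).mul (continuous_su2a0.comp hP'c)).mul
      ((continuous_su2Character_comp _ hPc).mul (continuous_su2Character_comp _ hP'c))
  have hGsu : ∀ (e : Edge 2 L) g V, e.2 = 1 ∨ (e.1 1 ≠ j ∧ e.1 1 ≠ j + T) → Gs (update V e g) = Gs V := by
    intro e g V he
    simp only [hGs]
    rcases he with he | he
    · rw [hPu e g V (Or.inl he), hP'u e g V (Or.inl he)]
    · rw [hPu e g V (Or.inr he.1), hP'u e g V (Or.inr he.2)]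
  have hre2 : ∀ V : GaugeConfig 2 L (Matrix.specialUnitaryGroup (Fin 2) ℂ),
      su2a0 (P V) * su2a0 (P' V) * ρ' V * ((U ℝ μ).eval (su2a0 (P V)) * (U ℝ μ).eval (su2a0 (P' V))) =
      Gs V * ∏ b ∈ range (L - T), ∏ a ∈ range L,
        (U ℝ (m ![i + a, j + T + b])).eval (su2a0 (plaquetteHolonomy V ![i + a, j + T + b] 0 1)) := by
    intro V
    simp only [hGs, hρ']
    ring
  simp_rw [hre2]
  rw [integral_mul_prod_annulus_su2Character i (j + T) m (T := L - T) (by omega) (by omega) Gs hGsc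
    (fun a b ha hb V g => hGsu _ g V (Or.inl rfl))
    (fun b hb0 hb V g => hGsu _ g V (Or.inr ⟨?_, ?_⟩))]
  rotate_left
  · change j + (T : ZMod L) + (b : ZMod L) ≠ j
    rw [add_assoc, ← Nat.cast_add]
    exact fun h => absurd (Nat.le_of_dvd (by omega) ((ZMod.natCast_eq_zero_iff (T + b) L).1
      (add_eq_left.mp h))) (by omega)
  · change j + (T : ZMod L) + (b : ZMod L) ≠ j + (T : ZMod L)
    exact fun h => absurd (Nat.le_of_dvd hb0 ((ZMod.natCast_eq_zero_iff b L).1 (add_eq_left.mp h)))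
      (by omega)
  by_cases hC2 : ∀ a < L, ∀ b < L - T, m ![i + a, j + T + b] = m ![i, j + T]
  swap
  · rw [if_neg hC2, if_neg hC2, mul_zero]
  rw [if_pos hC2, if_pos hC2]
  -- the top circle of the second annulus is `P_j`
  have htop : j + (T : ZMod L) + ((L - T : ℕ) : ZMod L) = j := by
    rw [add_assoc, ← Nat.cast_add, Nat.add_sub_cancel' hTL'.le, ZMod.natCast_self, add_zero]
  simp_rw [htop, hPdef, hP'def]
  -- Step 3: the two circles are independent Haar variables
  set ν := m ![i, j + T] with hν
  set Φ : Matrix.specialUnitaryGroup (Fin 2) ℂ → ℝ := fun g =>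
    su2a0 g * ((U ℝ μ).eval (su2a0 g) * (U ℝ ν).eval (su2a0 g)) with hΦ
  have hΦc : Continuous Φ := by
    simp only [hΦ]
    exact continuous_su2a0.mul ((continuous_su2Character_comp _ continuous_id).mul
      (continuous_su2Character_comp _ continuous_id))
  have hre3 : ∀ V : GaugeConfig 2 L (Matrix.specialUnitaryGroup (Fin 2) ℂ),
      Gs V * ((U ℝ ν).eval (su2a0 (P' V)) * (U ℝ ν).eval (su2a0 (P V))) = Φ (P V) * Φ (P' V) := by
    intro V
    simp only [hGs, hΦ]
    ring
  simp_rw [hre3]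
  have hκ : ∫ g, Φ g ∂(haarProbability (Matrix.specialUnitaryGroup (Fin 2) ℂ)) =
      (1 / 2) * (if ν = μ + 1 then (1 : ℝ) else 0) +
        (1 / 2) * (if μ = 0 then (0 : ℝ) else if ν = μ - 1 then 1 else 0) := by
    simp only [hΦ]
    simp_rw [← mul_assoc]
    exact integral_su2a0_mul_su2Character_mul_su2Character μ ν
  obtain ⟨L₀, rfl⟩ : ∃ L₀, L = L₀ + 1 := ⟨L - 1, by omega⟩
  -- peel the first link off each circle
  have hrow : ∀ (V : GaugeConfig 2 (L₀ + 1) (Matrix.specialUnitaryGroup (Fin 2) ℂ)) (y : ZMod (L₀ + 1)),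
      ((List.range (L₀ + 1)).map fun a : ℕ => V (![i + a, y], 0)).prod =
        V (![i, y], 0) * ((List.range L₀).map fun a : ℕ => V (![i + (a + 1 : ℕ), y], 0)).prod := by
    intro V y
    rw [list_prod_range_succ_eq_head_mul, Nat.cast_zero, add_zero]
  have hrest : ∀ (y : ZMod (L₀ + 1)) (w : GaugeConfig 2 (L₀ + 1) (Matrix.specialUnitaryGroup (Fin 2) ℂ)) g,
      ((List.range L₀).map fun a : ℕ => update w (![i, y], 0) g (![i + (a + 1 : ℕ), y], 0)).prod =
        ((List.range L₀).map fun a : ℕ => w (![i + (a + 1 : ℕ), y], 0)).prod := by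
    intro y w g
    refine list_prod_map_update_of_ne w _ g _ _ fun k hk h => ?_
    rw [List.mem_range] at hk
    rw [Prod.mk.injEq, vec2_eq_iff] at h
    exact absurd (Nat.le_of_dvd (Nat.succ_pos k) ((ZMod.natCast_eq_zero_iff (k + 1) (L₀ + 1)).1
      (add_eq_left.mp h.1.1))) (by omega)
  have hrestc : ∀ y : ZMod (L₀ + 1), Continuous fun w : GaugeConfig 2 (L₀ + 1) (Matrix.specialUnitaryGroup (Fin 2) ℂ) =>
      w (![i, y], 0) * ((List.range L₀).map fun a : ℕ => w (![i + (a + 1 : ℕ), y], 0)).prod :=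
    fun y => (continuous_apply _).mul (continuous_list_prod _ fun k _ => continuous_apply _)
  have hPeq : ∀ V, P V = V (![i, j], 0) * ((List.range L₀).map fun a : ℕ => V (![i + (a + 1 : ℕ), j], 0)).prod :=
    fun V => hrow V j
  have hP'eq : ∀ V, P' V = V (![i, j + ((T : ℕ) : ZMod (L₀ + 1))], 0) *
      ((List.range L₀).map fun a : ℕ => V (![i + (a + 1 : ℕ), j + ((T : ℕ) : ZMod (L₀ + 1))], 0)).prod :=
    fun V => hrow V _
  simp_rw [hPeq]
  have h1 := integral_pi_haar_mul_of_update_eq (ι := Edge 2 (L₀ + 1))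
    (haarProbability (Matrix.specialUnitaryGroup (Fin 2) ℂ)) (![i, j], 0)
    (fun w => ((List.range L₀).map fun a : ℕ => w (![i + (a + 1 : ℕ), j], 0)).prod) (hrest j)
    (fun V => Φ (P' V)) (fun V g => by
      show Φ (P' _) = Φ (P' V)
      rw [hP'u _ g V (Or.inr ?_)]
      change j ≠ j + ((T : ℕ) : ZMod (L₀ + 1))
      exact fun h => hT0 (left_eq_add.mp h))
    Φ (integrable_pi_su2_of_continuous ((hΦc.comp (hrestc j)).mul (hΦc.comp hP'c)))
  rw [h1]
  simp_rw [hP'eq]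
  have h2 := integral_pi_mul_of_update_eq (ι := Edge 2 (L₀ + 1))
    (haarProbability (Matrix.specialUnitaryGroup (Fin 2) ℂ)) (![i, j + ((T : ℕ) : ZMod (L₀ + 1))], 0)
    (fun w => ((List.range L₀).map fun a : ℕ => w (![i + (a + 1 : ℕ), j + ((T : ℕ) : ZMod (L₀ + 1))], 0)).prod)
    (hrest _) Φ (integrable_pi_su2_of_continuous (hΦc.comp (hrestc _)))
  rw [h2, hκ, sq]

end Summit.Ventures.LatticeQCDFlow.Scoring
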